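/-
COR-CM (cell pub-hodgecm2, stage 2 of the Hodge ladder) — count-neutral KERNEL COMBINATORICS «the census → tree TRANSPORT» (seat
prover-pub-hodgecm2-b23-g32-0, binder prover b23, gen 32; claim INT2-TRANSPORT F2, HOME/lit/LIT-STATUS.md 2026-08-21T15:20:31Z;
sequel of `CorCM/FaceCensusCells.lean`).  Theorems only; no geometry beyond the by-name INT-2 consumer of
`CorCM/FacePeriodsGeneratingSet.lean`; no definition, no named fact, nothing asserted.  Seat b30's census engine and certificate
checkers (`Census/FaceSquaresModel.lean`, `Census/FaceSquaresLattice.lean`: `inOrbits`, `comboVal`, `certOK`, `generationCertOK`)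
are consumed BY NAME; nothing of theirs is restated or re-filed; `Interfaces.lean` (C1), every E term, B01 and `Transposition/*` are
untouched.
HONEST FRAMING (COORDINATOR RULING — HODGE FRAMING CORRECTION, 2026-08-21T11:55:35Z): `HC_CM` is NOT proved, here or anywhere in
the tree.  The closing theorems of §4 are CONDITIONAL on face-period witnesses for the listed faces of ONE field; nothing is
discharged for any particular field here.
T5 (coordinator ruling 15:33:56Z (3), lead staging l.4095): NO named-fact / conjecture-def / summit-side supply binder is INTRODUCED here;
binder sets: (Γ, e, hmul, hconj) inhabited for every Galois CM field by transport of structure (see `FaceCensusDictionary.lean`);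
(hcert, horb, hpc) are closed Bool equations DISCHARGED per type by `decide` in `Census/OcticFaceTransport*.lean` (not posited);
hreps is INHABITED in the kernel for every `r ∈ Γ.faces` (`FaceCensus.exists_face_reads`, `CorCM/FaceCensusCells.lean`); the one
remaining hypothesis family of §4 is the face-period witness / Weil-line algebraicity on the listed faces = instances of the
crux (`FacePeriodExists` / B01-S), for which the tree has no `¬` theorem on the universe of record (the vacuity kills
`not_exists_periodNV_free_perLShadow` concern the PerL SHADOW universe) — no contradiction derivable; checker: self
(prover-pub-hodgecm2-b23-g32-0), 2026-08-21T16:20Z.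
-/
import Summits.HodgeConjecture.CorCM.FaceCensusCells
import Summits.HodgeConjecture.CorCM.FacePeriodsGeneratingSet
import HarnessLib

/-!
# The census → tree transport: b30's bitmask generation certificates give the generation binder `hgen`

The generating-set face reduction (INT2-GEN, `hodgeConjectureFor_of_avDominatedBy_isProductOf_of_exists_facePeriod_on`,
`CorCM/FacePeriodsGeneratingSet.lean`) carries ONE combinatorial binder
`hgen : ∀ f : Face K, lefChar f.corner (fun _ ↦ {σ₀}) ∈ AddSubgroup.closure {lefChar g.corner (fun _ ↦ {σ}) | g ∈ 𝒮, σ}`.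
Seat b30's per-type census files certify, in the finite model `(G, c)` of a Galois CM closure type, identities
`1_{corners f} = Σ_i c_i · 1_{corners g_i} + Σ_j d_j · 1_{{P_j, P̄_j}}` for EVERY face `f`, with every `g_i` in the orbit of a
member of the representative list `reps` (`Γ.generationCertOK reps certs = true`, `Census/FaceSquaresLattice.lean`).  This file
TRANSPORTS such a certificate to the literal binder `hgen` for a Galois CM field `F` of that type:

**`hgen_of_generationCertOK`.**  Given an enumeration `e : GalT F ≃ Fin n` with `e (P * Q) = Γ.mul (e P) (e Q)`,
`e conjT = Γ.conj` (the dictionary datum of `CorCM/FaceCensusDictionary.lean`), a base embedding `σ₀`, a set `𝒮` of faces of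
`F` containing for every `r ∈ reps` a face with code `r` (type code of `pullType g.Φ σ₀` = `r.1`, place masks `r.2.1`, `r.2.2`),
b30's certificate `Γ.generationCertOK reps certs = true` and three closed side checks on the same data (decided per type in
`Census/OcticFaceTransport.lean`: every generator face lies in an explicit eight-face orbit cell of a representative; every pair
label is a CM type; —), the binder `hgen(𝒮, σ₀)` holds at every face.

Route of the proof (no `PeriodNV` is transported, no list normal form is reasoned about):
* §1 square mates and place swaps of a face have corner indicators `= ±` the face's `+` the four pairs of its square
  (`weightRel_corner_swap`, `weightRel_corner_flip_add_mem_pairRel`, `weightRel_corner_flipflip`);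
* §2 a Galois twist of a representative `R ∈ 𝒮` by `g_j` is `R` READ AT THE BASE EMBEDDING `(e⁻¹ j)⁻¹ σ₀`
  (`code_pullType_baseChange`), so each of the eight faces of an orbit cell has a corner indicator in
  `span ℤ {weightRel g.corner (fun _ ↦ {σ}) | g ∈ 𝒮, σ} ⊔ pairRel` evaluating, through the dictionary, to b30's `1_{corners g_i}`
  (`exists_repr_of_mem_cell`);
* §3 the certificate identity, evaluated at the code of every abstract CM type, is unwound by induction on its two lists into
  `weightRel f.corner (fun _ ↦ {σ₀}) ∈ span ⊔ pairRel` (`weightRel_mem_of_generationCertOK`), and the pre-quotient socket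
  `hgen_of_weightRel_mem_span` (`CorCM/FaceCharacterSaturation.lean`) gives `hgen`;
* §4 BY NAME over INT2-GEN: period witnesses (or algebraic Weil lines) on the faces of `𝒮` ⟹ the Hodge conjecture for every
  abelian variety dominated by a product of CM abelian varieties with CM types of subfields of `K` — for ONE Galois CM field `K`
  of the certified type.  `HC_CM` is not proved.

References: [QW8] Def. 2.3 / Thm 2.5 and rfwf v3 §8 (the cell's 2001 sources); [cite: Pohlmann1968, Thm. 1];
[cite: Milne1999LefschetzClasses, Thm. 3.2 and Cor. 4.5]; [cite: Shimura1998, §6.2 Theorem 3 and §6.1 Corollary of Theorem 2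
(pp. 41–43)]; [cite: MumfordAV1970, §19 Thm. 1 and p. 169].
-/

noncomputable section

open NumberField NumberField.ComplexEmbedding
open scoped symmDiff

namespace Summit.HodgeConjecture.CorCM.FaceCensus

open Literature.AlgebraicGeometry.Motives (CMType)
open Literature.NumberTheory.ComplexMultiplication.CMTypeOps
open Summit.HodgeConjecture.CorCM.Prior.AllgGroup.RfwfAllgGroup
open Summit.HodgeConjecture.CorCM.Census.FaceSquaresModel

variable {F : Type} [Field F] [NumberField F]

variable [IsGalois ℚ F] {n : ℕ} (Γ : CMGaloisType n) (e : GalT F ≃ Fin n)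


/-! ## §3 The certificate identity unwound: `weightRel f.corner (fun _ ↦ {σ₀}) ∈ span ⊔ pairRel`, hence `hgen` -/

omit [IsGalois ℚ F] in
/-- A pair label that is a CM type of the model decodes to a pair relation evaluating, through the dictionary, to b30's pair
indicator. [folklore] -/
theorem exists_pair_of_isCMType (hmul : ∀ P Q : GalT F, e (P * Q) = Γ.mul (e P) (e Q)) (hconj : e conjT = Γ.conj)
    {L : ℕ} (hL : Γ.isCMType L = true) :
    ∃ Y ∈ (pairRel : Submodule ℤ (CMF (GalT F) conjT →₀ ℤ)),
      ∀ (Ψ : CMF (GalT F) conjT) (S : ℕ), (S < 2 ^ n ∧ ∀ i : Fin n, mem i S = true ↔ e.symm i ∈ Ψ.1) →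
        Y Ψ = (if S = L then 1 else 0) + (if S = Γ.bar L then 1 else 0) := by
  obtain ⟨Ψ₀, h₀⟩ := exists_of_isCMType Γ e hmul hconj hL
  refine ⟨Finsupp.single Ψ₀ 1 + Finsupp.single (barCM Ψ₀) 1, Submodule.subset_span ⟨Ψ₀, rfl⟩, fun Ψ S hS => ?_⟩
  simp only [Finsupp.add_apply, Finsupp.single_apply]
  have e1 : Ψ₀ = Ψ ↔ S = L := (eq_iff_code_eq e h₀ hS).trans eq_comm
  have e2 : barCM Ψ₀ = Ψ ↔ S = Γ.bar L := (eq_iff_code_eq e (code_bar Γ e hmul hconj h₀) hS).trans eq_comm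
  by_cases h1 : Ψ₀ = Ψ <;> by_cases h2 : barCM Ψ₀ = Ψ
  · rw [if_pos h1, if_pos h2, if_pos (e1.mp h1), if_pos (e2.mp h2)]
  · rw [if_pos h1, if_neg h2, if_pos (e1.mp h1), if_neg (fun h => h2 (e2.mpr h))]
  · rw [if_neg h1, if_pos h2, if_neg (fun h => h1 (e1.mpr h)), if_pos (e2.mp h2)]
  · rw [if_neg h1, if_neg h2, if_neg (fun h => h1 (e1.mpr h)), if_neg (fun h => h2 (e2.mpr h))]

/-- `comboVal` with one more generator face. [folklore] -/
theorem comboVal_cons (gi : (ℕ × ℕ × ℕ) × ℤ) (fc : List ((ℕ × ℕ × ℕ) × ℤ)) (pc : List (ℕ × ℤ)) (L : ℕ) :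
    Γ.comboVal (gi :: fc) pc L = (if (Γ.corners gi.1).contains L then gi.2 else 0) + Γ.comboVal fc pc L := by
  unfold CMGaloisType.comboVal
  rw [List.map_cons, List.sum_cons, add_assoc]

/-- `comboVal` with no generator face and one more pair. [folklore] -/
theorem comboVal_nil_cons (pj : ℕ × ℤ) (pc : List (ℕ × ℤ)) (L : ℕ) :
    Γ.comboVal [] (pj :: pc) L =
      ((if L == pj.1 then pj.2 else 0) + (if L == Γ.bar pj.1 then pj.2 else 0)) + Γ.comboVal [] pc L := by
  unfold CMGaloisType.comboVal
  rw [List.map_cons, List.sum_cons, List.map_nil, List.sum_nil, zero_add, zero_add]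

/-- `comboVal` of the empty certificate vanishes. [folklore] -/
theorem comboVal_nil_nil (L : ℕ) : Γ.comboVal [] [] L = 0 := by
  unfold CMGaloisType.comboVal
  rw [List.map_nil, List.sum_nil, List.map_nil, List.sum_nil, zero_add]

/-- **Unwinding a certificate identity.**  If `v` evaluates, through the dictionary, to b30's combination `comboVal fc pc` whose
generator faces lie in explicit orbit cells of representatives having faces in `𝒮` and whose pair labels are CM types, then
`v ∈ span ℤ {weightRel g.corner (fun _ ↦ {σ}) | g ∈ 𝒮, σ} ⊔ pairRel`.  (Induction on the two lists.) [folklore] -/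
theorem mem_of_eval_eq_comboVal (hmul : ∀ P Q : GalT F, e (P * Q) = Γ.mul (e P) (e Q)) (hconj : e conjT = Γ.conj)
    (σ₀ : F →+* ℂ) (𝒮 : Set (Face F)) (reps : List (ℕ × ℕ × ℕ))
    (hreps : ∀ r ∈ reps, ∃ R ∈ 𝒮, (r.1 < 2 ^ n ∧ ∀ i : Fin n, mem i r.1 = true ↔ e.symm i ∈ (pullType R.Φ σ₀).1) ∧
      Γ.placeMask (e (translate σ₀ R.p)) = r.2.1 ∧ Γ.placeMask (e (translate σ₀ R.p')) = r.2.2)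
    (fc : List ((ℕ × ℕ × ℕ) × ℤ)) (pc : List (ℕ × ℤ))
    (hfc : ∀ gi ∈ fc, ∃ r ∈ reps, ∃ j : Fin n, gi.1 ∈ [(Γ.twist j r.1, Γ.twist j r.2.1, Γ.twist j r.2.2),
      (flipAt (Γ.twist j r.2.1) (Γ.twist j r.1), Γ.twist j r.2.1, Γ.twist j r.2.2),
      (flipAt (Γ.twist j r.2.2) (Γ.twist j r.1), Γ.twist j r.2.1, Γ.twist j r.2.2),
      (flipAt (Γ.twist j r.2.2) (flipAt (Γ.twist j r.2.1) (Γ.twist j r.1)), Γ.twist j r.2.1, Γ.twist j r.2.2),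
      (Γ.twist j r.1, Γ.twist j r.2.2, Γ.twist j r.2.1),
      (flipAt (Γ.twist j r.2.1) (Γ.twist j r.1), Γ.twist j r.2.2, Γ.twist j r.2.1),
      (flipAt (Γ.twist j r.2.2) (Γ.twist j r.1), Γ.twist j r.2.2, Γ.twist j r.2.1),
      (flipAt (Γ.twist j r.2.2) (flipAt (Γ.twist j r.2.1) (Γ.twist j r.1)), Γ.twist j r.2.2, Γ.twist j r.2.1)])
    (hpc : ∀ pj ∈ pc, Γ.isCMType pj.1 = true) (v : CMF (GalT F) conjT →₀ ℤ)
    (hv : ∀ (Ψ : CMF (GalT F) conjT) (S : ℕ), (S < 2 ^ n ∧ ∀ i : Fin n, mem i S = true ↔ e.symm i ∈ Ψ.1) →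
      v Ψ = Γ.comboVal fc pc S) :
    v ∈ Submodule.span ℤ {y : CMF (GalT F) conjT →₀ ℤ | ∃ g ∈ 𝒮, ∃ σ : F →+* ℂ,
      y = weightRel g.corner (fun _ => ({σ} : Finset (F →+* ℂ)))} ⊔ pairRel := by
  induction fc generalizing v with
  | cons gi fc ih =>
    obtain ⟨r, hr, j, hcell⟩ := hfc gi List.mem_cons_self
    obtain ⟨R, hR, hcode⟩ := hreps r hr
    obtain ⟨X, hX, hXv⟩ := exists_repr_of_mem_cell Γ e hmul hconj σ₀ 𝒮 hR hcode j hcell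
    have hv' : ∀ (Ψ : CMF (GalT F) conjT) (S : ℕ), (S < 2 ^ n ∧ ∀ i : Fin n, mem i S = true ↔ e.symm i ∈ Ψ.1) →
        (v - gi.2 • X) Ψ = Γ.comboVal fc pc S := by
      intro Ψ S hS
      rw [Finsupp.sub_apply, Finsupp.smul_apply, hv Ψ S hS, hXv Ψ S hS, comboVal_cons, smul_eq_mul]
      split_ifs <;> ring
    have hmem := ih (fun gi' hgi' => hfc gi' (List.mem_cons_of_mem gi hgi')) (v - gi.2 • X) hv'
    have hv_eq : v = (v - gi.2 • X) + gi.2 • X := by abel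
    rw [hv_eq]
    exact Submodule.add_mem _ hmem (Submodule.smul_mem _ _ hX)
  | nil =>
    induction pc generalizing v with
    | cons pj pc ih =>
      obtain ⟨Y, hY, hYv⟩ := exists_pair_of_isCMType Γ e hmul hconj (hpc pj List.mem_cons_self)
      have hv' : ∀ (Ψ : CMF (GalT F) conjT) (S : ℕ), (S < 2 ^ n ∧ ∀ i : Fin n, mem i S = true ↔ e.symm i ∈ Ψ.1) →
          (v - pj.2 • Y) Ψ = Γ.comboVal [] pc S := by
        intro Ψ S hS
        rw [Finsupp.sub_apply, Finsupp.smul_apply, hv Ψ S hS, hYv Ψ S hS, comboVal_nil_cons, smul_eq_mul]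
        simp only [beq_iff_eq]
        split_ifs <;> ring
      have hmem := ih (fun pj' hpj' => hpc pj' (List.mem_cons_of_mem pj hpj')) (v - pj.2 • Y) hv'
      have hv_eq : v = (v - pj.2 • Y) + pj.2 • Y := by abel
      rw [hv_eq]
      exact Submodule.add_mem _ hmem (Submodule.mem_sup_right (Submodule.smul_mem _ _ hY))
    | nil =>
      have hv0 : v = 0 := by
        ext Ψ
        obtain ⟨S, hS⟩ := exists_code e Ψ
        rw [hv Ψ S hS, comboVal_nil_nil, Finsupp.zero_apply]
      rw [hv0]
      exact Submodule.zero_mem _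

/-- **THE TRANSPORT (pre-quotient form).**  Under the dictionary `(Γ, e)`, b30's generation certificate for the representative list
`reps` together with the two decidable side checks (orbit cells, pair labels) and a set `𝒮` of faces of `F` containing a face of
every representative code gives, for EVERY face `f` of `F`,
`weightRel f.corner (fun _ ↦ {σ₀}) ∈ span ℤ {weightRel g.corner (fun _ ↦ {σ}) | g ∈ 𝒮, σ} ⊔ pairRel`. [cite: Pohlmann1968, Thm. 1] -/
theorem weightRel_mem_of_generationCertOK
    (hmul : ∀ P Q : GalT F, e (P * Q) = Γ.mul (e P) (e Q)) (hconj : e conjT = Γ.conj)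
    (reps : List (ℕ × ℕ × ℕ)) (certs : List ((ℕ × ℕ × ℕ) × List ((ℕ × ℕ × ℕ) × ℤ) × List (ℕ × ℤ)))
    (hcert : Γ.generationCertOK reps certs = true)
    (horb : (certs.all fun c => c.2.1.all fun gi => reps.any fun r => (List.finRange n).any fun j =>
      [(Γ.twist j r.1, Γ.twist j r.2.1, Γ.twist j r.2.2),
        (flipAt (Γ.twist j r.2.1) (Γ.twist j r.1), Γ.twist j r.2.1, Γ.twist j r.2.2),
        (flipAt (Γ.twist j r.2.2) (Γ.twist j r.1), Γ.twist j r.2.1, Γ.twist j r.2.2),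
        (flipAt (Γ.twist j r.2.2) (flipAt (Γ.twist j r.2.1) (Γ.twist j r.1)), Γ.twist j r.2.1, Γ.twist j r.2.2),
        (Γ.twist j r.1, Γ.twist j r.2.2, Γ.twist j r.2.1),
        (flipAt (Γ.twist j r.2.1) (Γ.twist j r.1), Γ.twist j r.2.2, Γ.twist j r.2.1),
        (flipAt (Γ.twist j r.2.2) (Γ.twist j r.1), Γ.twist j r.2.2, Γ.twist j r.2.1),
        (flipAt (Γ.twist j r.2.2) (flipAt (Γ.twist j r.2.1) (Γ.twist j r.1)), Γ.twist j r.2.2, Γ.twist j r.2.1)].contains gi.1)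
      = true)
    (hpc : (certs.all fun c => c.2.2.all fun pj => Γ.isCMType pj.1) = true)
    (σ₀ : F →+* ℂ) (𝒮 : Set (Face F))
    (hreps : ∀ r ∈ reps, ∃ R ∈ 𝒮, (r.1 < 2 ^ n ∧ ∀ i : Fin n, mem i r.1 = true ↔ e.symm i ∈ (pullType R.Φ σ₀).1) ∧
      Γ.placeMask (e (translate σ₀ R.p)) = r.2.1 ∧ Γ.placeMask (e (translate σ₀ R.p')) = r.2.2)
    (f : Face F) :
    weightRel f.corner (fun _ => ({σ₀} : Finset (F →+* ℂ))) ∈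
      Submodule.span ℤ {y : CMF (GalT F) conjT →₀ ℤ | ∃ g ∈ 𝒮, ∃ σ : F →+* ℂ,
        y = weightRel g.corner (fun _ => ({σ} : Finset (F →+* ℂ)))} ⊔ pairRel := by
  -- the face `f` read at `σ₀` is a face of the model; fetch its certificate
  obtain ⟨T, hT⟩ := exists_code e (pullType f.Φ σ₀)
  have hφ := faceCode_mem_faces Γ e hmul hconj f σ₀ hT
  unfold CMGaloisType.generationCertOK at hcert
  rw [List.all_eq_true] at hcert
  obtain ⟨c, hc, hcφ⟩ := List.any_eq_true.mp (hcert _ hφ)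
  rw [Bool.and_eq_true] at hcφ
  obtain ⟨-, hOK⟩ := hcφ
  unfold CMGaloisType.certOK at hOK
  rw [Bool.and_eq_true, List.all_eq_true, List.all_eq_true] at hOK
  -- generator faces lie in orbit cells
  rw [List.all_eq_true] at horb hpc
  have hfc : ∀ gi ∈ c.2.1, ∃ r ∈ reps, ∃ j : Fin n, gi.1 ∈ [(Γ.twist j r.1, Γ.twist j r.2.1, Γ.twist j r.2.2),
      (flipAt (Γ.twist j r.2.1) (Γ.twist j r.1), Γ.twist j r.2.1, Γ.twist j r.2.2),
      (flipAt (Γ.twist j r.2.2) (Γ.twist j r.1), Γ.twist j r.2.1, Γ.twist j r.2.2),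
      (flipAt (Γ.twist j r.2.2) (flipAt (Γ.twist j r.2.1) (Γ.twist j r.1)), Γ.twist j r.2.1, Γ.twist j r.2.2),
      (Γ.twist j r.1, Γ.twist j r.2.2, Γ.twist j r.2.1),
      (flipAt (Γ.twist j r.2.1) (Γ.twist j r.1), Γ.twist j r.2.2, Γ.twist j r.2.1),
      (flipAt (Γ.twist j r.2.2) (Γ.twist j r.1), Γ.twist j r.2.2, Γ.twist j r.2.1),
      (flipAt (Γ.twist j r.2.2) (flipAt (Γ.twist j r.2.1) (Γ.twist j r.1)), Γ.twist j r.2.2, Γ.twist j r.2.1)] := by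
    intro gi hgi
    have h := List.all_eq_true.mp (horb c hc) gi hgi
    obtain ⟨r, hr, h⟩ := List.any_eq_true.mp h
    obtain ⟨j, -, h⟩ := List.any_eq_true.mp h
    exact ⟨r, hr, j, List.contains_iff_mem.mp h⟩
  refine mem_of_eval_eq_comboVal Γ e hmul hconj σ₀ 𝒮 reps hreps c.2.1 c.2.2 hfc (List.all_eq_true.mp (hpc c hc)) _
    fun Ψ S hS => ?_
  rw [weightRel_corner_apply Γ e hmul hconj f σ₀ hT Ψ hS]
  exact beq_iff_eq.mp (hOK.2 S (code_mem_cmTypes Γ e hmul hconj hS))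

/-- **THE TRANSPORT.**  Under the dictionary `(Γ, e)` — `e : GalT F ≃ Fin n` multiplicative for the Cayley table with
`e conjT = Γ.conj` — seat b30's generation certificate `Γ.generationCertOK reps certs = true` together with the two decidable side
checks (every generator face of a certificate lies in an explicit eight-face orbit cell of a representative; every pair label
is a CM type of the model) and a set `𝒮` of faces of `F` containing, for every representative code `r ∈ reps`, a face `R` READ AS `r` at `σ₀`
(`pullType R.Φ σ₀` has code `r.1`, the places of `R` have masks `r.2.1`, `r.2.2`), gives the generation binder of INT2-GEN:
`hgen(𝒮, σ₀)` — every `σ₀`-Weil character of every face of `F` lies in the subgroup of `Asym F` generated by the Weil characters of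
the faces of `𝒮` at all base embeddings. [cite: Pohlmann1968, Thm. 1] [cite: Milne1999LefschetzClasses, Thm. 3.2] -/
theorem hgen_of_generationCertOK (hmul : ∀ P Q : GalT F, e (P * Q) = Γ.mul (e P) (e Q)) (hconj : e conjT = Γ.conj)
    (reps : List (ℕ × ℕ × ℕ)) (certs : List ((ℕ × ℕ × ℕ) × List ((ℕ × ℕ × ℕ) × ℤ) × List (ℕ × ℤ)))
    (hcert : Γ.generationCertOK reps certs = true)
    (horb : (certs.all fun c => c.2.1.all fun gi => reps.any fun r => (List.finRange n).any fun j =>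
      [(Γ.twist j r.1, Γ.twist j r.2.1, Γ.twist j r.2.2),
        (flipAt (Γ.twist j r.2.1) (Γ.twist j r.1), Γ.twist j r.2.1, Γ.twist j r.2.2),
        (flipAt (Γ.twist j r.2.2) (Γ.twist j r.1), Γ.twist j r.2.1, Γ.twist j r.2.2),
        (flipAt (Γ.twist j r.2.2) (flipAt (Γ.twist j r.2.1) (Γ.twist j r.1)), Γ.twist j r.2.1, Γ.twist j r.2.2),
        (Γ.twist j r.1, Γ.twist j r.2.2, Γ.twist j r.2.1),
        (flipAt (Γ.twist j r.2.1) (Γ.twist j r.1), Γ.twist j r.2.2, Γ.twist j r.2.1),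
        (flipAt (Γ.twist j r.2.2) (Γ.twist j r.1), Γ.twist j r.2.2, Γ.twist j r.2.1),
        (flipAt (Γ.twist j r.2.2) (flipAt (Γ.twist j r.2.1) (Γ.twist j r.1)), Γ.twist j r.2.2, Γ.twist j r.2.1)].contains gi.1)
      = true)
    (hpc : (certs.all fun c => c.2.2.all fun pj => Γ.isCMType pj.1) = true)
    (σ₀ : F →+* ℂ) (𝒮 : Set (Face F))
    (hreps : ∀ r ∈ reps, ∃ R ∈ 𝒮, (r.1 < 2 ^ n ∧ ∀ i : Fin n, mem i r.1 = true ↔ e.symm i ∈ (pullType R.Φ σ₀).1) ∧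
      Γ.placeMask (e (translate σ₀ R.p)) = r.2.1 ∧ Γ.placeMask (e (translate σ₀ R.p')) = r.2.2)
    (f : Face F) :
    lefChar f.corner (fun _ => ({σ₀} : Finset (F →+* ℂ))) ∈ AddSubgroup.closure
      {a : Asym F | ∃ g ∈ 𝒮, ∃ σ : F →+* ℂ, a = lefChar g.corner (fun _ => ({σ} : Finset (F →+* ℂ)))} :=
  hgen_of_weightRel_mem_span 𝒮 σ₀
    (weightRel_mem_of_generationCertOK Γ e hmul hconj reps certs hcert horb hpc σ₀ 𝒮 hreps) f

omit Γ e in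
/-- `|GalT F| = [F:ℚ]` for a Galois number field (simple transitivity on `Hom(F, ℂ)`). [folklore] -/
theorem card_galT : Fintype.card (GalT F) = Module.finrank ℚ F := by
  obtain ⟨σ₀⟩ : Nonempty (F →+* ℂ) := by
    have hc : 0 < Fintype.card (F →+* ℂ) := by
      rw [Embeddings.card]; exact Module.finrank_pos
    exact Fintype.card_pos_iff.mp hc
  rw [← Embeddings.card F ℂ]
  exact Fintype.card_of_bijective (f := fun P : GalT F => P.1 σ₀)
    ⟨fun P Q h => GalT.ext_of_apply σ₀ h, fun ρ => ⟨translate σ₀ ρ, translate_apply_self σ₀ ρ⟩⟩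

omit Γ in
include e in
/-- An enumeration by `Fin n` forces `n = [F:ℚ]`. [folklore] -/
theorem eq_finrank_of_enum : n = Module.finrank ℚ F := by
  have h := Fintype.card_congr e
  rw [Fintype.card_fin, card_galT] at h
  exact h.symm

end Summit.HodgeConjecture.CorCM.FaceCensus

/-! ## §4 INT-2 through the transport, CLOSED on the universe of record (BY NAME over `CorCM/FacePeriodsGeneratingSet.lean`) -/

namespace Summit.HodgeConjecture.CorCM

open CategoryTheory
open Literature.AlgebraicGeometry Literature.AlgebraicGeometry.Motives Literature.AlgebraicGeometry.HodgeTheory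
open Literature.AlgebraicGeometry.ComplexMultiplication Literature.AlgebraicGeometry.Milne1999
open Literature.NumberTheory.Automorphic
open Literature.NumberTheory.Automorphic.PicardCM
open Summit.HodgeConjecture.CorCM.Census.FaceSquaresModel (CMGaloisType mem flipAt)
open Summit.HodgeConjecture.CorCM.Domination

/-- **INT-2 THROUGH THE CENSUS TRANSPORT — Weil-line form, CLOSED.**  For ONE Galois CM field `K` enumerated against a certified
census type `(Γ, reps, certs)` (b30's `generationCertOK` + the two side checks) and a set `𝒮` of faces of `K` reading as the
representatives at `σ₀`: if the Weil lines of the faces of `𝒮` are algebraic on the universe of record, then every complex abelian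
variety dominated by a finite product of abelian varieties realising CM types of CM fields embeddable in `K` satisfies the Hodge
conjecture in every codimension.  (FRAMING: conditional on those Weil lines; `HC_CM` is not proved.)
[cite: Pohlmann1968, Thm. 1] [cite: Milne1999LefschetzClasses, Thm. 3.2 and Cor. 4.5]
[cite: Shimura1998, §6.2 Theorem 3 and §6.1 Corollary of Theorem 2 (pp. 41–43)] [cite: MumfordAV1970, §19 Thm. 1 and p. 169] -/
theorem hodgeConjectureFor_of_avDominatedBy_isProductOf_of_weilFaceAlgebraic_of_generationCertOK (K : CMField)
    [hGal : IsGalois ℚ K] {n : ℕ} (h6 : 6 ≤ n) (Γ : CMGaloisType n) (e : GalT K ≃ Fin n)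
    (hmul : ∀ P Q : GalT K, e (P * Q) = Γ.mul (e P) (e Q)) (hconj : e conjT = Γ.conj)
    (reps : List (ℕ × ℕ × ℕ)) (certs : List ((ℕ × ℕ × ℕ) × List ((ℕ × ℕ × ℕ) × ℤ) × List (ℕ × ℤ)))
    (hcert : Γ.generationCertOK reps certs = true)
    (horb : (certs.all fun c => c.2.1.all fun gi => reps.any fun r => (List.finRange n).any fun j =>
      [(Γ.twist j r.1, Γ.twist j r.2.1, Γ.twist j r.2.2),
        (flipAt (Γ.twist j r.2.1) (Γ.twist j r.1), Γ.twist j r.2.1, Γ.twist j r.2.2),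
        (flipAt (Γ.twist j r.2.2) (Γ.twist j r.1), Γ.twist j r.2.1, Γ.twist j r.2.2),
        (flipAt (Γ.twist j r.2.2) (flipAt (Γ.twist j r.2.1) (Γ.twist j r.1)), Γ.twist j r.2.1, Γ.twist j r.2.2),
        (Γ.twist j r.1, Γ.twist j r.2.2, Γ.twist j r.2.1),
        (flipAt (Γ.twist j r.2.1) (Γ.twist j r.1), Γ.twist j r.2.2, Γ.twist j r.2.1),
        (flipAt (Γ.twist j r.2.2) (Γ.twist j r.1), Γ.twist j r.2.2, Γ.twist j r.2.1),
        (flipAt (Γ.twist j r.2.2) (flipAt (Γ.twist j r.2.1) (Γ.twist j r.1)), Γ.twist j r.2.2, Γ.twist j r.2.1)].contains gi.1)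
      = true)
    (hpc : (certs.all fun c => c.2.2.all fun pj => Γ.isCMType pj.1) = true)
    (σ₀ : (K : Type) →+* ℂ) (𝒮 : Set (Face K))
    (hreps : ∀ r ∈ reps, ∃ R ∈ 𝒮, (r.1 < 2 ^ n ∧ ∀ i : Fin n, mem i r.1 = true ↔ e.symm i ∈ (pullType R.Φ σ₀).1) ∧
      Γ.placeMask (e (translate σ₀ R.p)) = r.2.1 ∧ Γ.placeMask (e (translate σ₀ R.p')) = r.2.2)
    (hWeil : ∀ f ∈ 𝒮, (Model.picardCMUniverse exists_isReal_hodgeModel_holds hodgePQ_independent_of_hodgeModel_holds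
      BallQuotient.ballQuotientUniformised_holds cmAbelianVarietyRealised_holds).WeilFaceAlgebraic K f)
    {P A : AbelianVariety ℂ} (hP : AbelianVariety.IsProductOf (fun B : AbelianVariety ℂ =>
      ∃ (E : Type) (_ : Field E) (_ : NumberField E) (_ : IsCMField E) (_ : E →+* (K : Type)) (Φ : CMType E)
        (ι : 𝓞 E →+* End B) (θ : E →+* Module.End ℂ (complexBetti B.X 1)),
        IsCMTypeRealisation Φ B ι θ) P)
    (hA : AVDominatedBy A P) : HodgeConjectureFor A.dim A.X :=
  hodgeConjectureFor_of_avDominatedBy_isProductOf_of_weilFaceAlgebraic_on K (h6.trans_eq (FaceCensus.eq_finrank_of_enum e)) 𝒮 σ₀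
    (FaceCensus.hgen_of_generationCertOK Γ e hmul hconj reps certs hcert horb hpc σ₀ 𝒮 hreps) hWeil hP hA

/-- **INT-2 THROUGH THE CENSUS TRANSPORT — period-witness form, CLOSED (headline).**  For ONE Galois CM field `K` enumerated
against a certified census type `(Γ, reps, certs)` and a set `𝒮` of faces of `K` reading as the representatives at `σ₀`: ONE
period witness per face OF `𝒮` on the universe of record (some admissible `ι₁`, some hermitian 3-space `V`, some level,
eigenforms at some `σ`) implies the Hodge conjecture, in every codimension, for every complex abelian variety `A` dominated by a
finite product of abelian varieties each realising a CM type of a CM field `E` with `E →+* K`.  NO other hypothesis beyond the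
census data decided per type in `Census/OcticFaceTransport.lean`.  (FRAMING: a statement about the abelian varieties generated by
ONE field `K`, conditional on the face periods of `𝒮`; `HC_CM` is not proved.)
[cite: Shimura1998, §6.2 Theorem 3 and §6.1 Corollary of Theorem 2 (pp. 41–43)] [cite: Pohlmann1968, Thm. 1]
[cite: Milne1999LefschetzClasses, Thm. 3.2 and Cor. 4.5] [cite: MumfordAV1970, §19 Thm. 1 and p. 169] -/
theorem hodgeConjectureFor_of_avDominatedBy_isProductOf_of_exists_facePeriod_of_generationCertOK (K : CMField)
    [hGal : IsGalois ℚ K] {n : ℕ} (h6 : 6 ≤ n) (Γ : CMGaloisType n) (e : GalT K ≃ Fin n)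
    (hmul : ∀ P Q : GalT K, e (P * Q) = Γ.mul (e P) (e Q)) (hconj : e conjT = Γ.conj)
    (reps : List (ℕ × ℕ × ℕ)) (certs : List ((ℕ × ℕ × ℕ) × List ((ℕ × ℕ × ℕ) × ℤ) × List (ℕ × ℤ)))
    (hcert : Γ.generationCertOK reps certs = true)
    (horb : (certs.all fun c => c.2.1.all fun gi => reps.any fun r => (List.finRange n).any fun j =>
      [(Γ.twist j r.1, Γ.twist j r.2.1, Γ.twist j r.2.2),
        (flipAt (Γ.twist j r.2.1) (Γ.twist j r.1), Γ.twist j r.2.1, Γ.twist j r.2.2),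
        (flipAt (Γ.twist j r.2.2) (Γ.twist j r.1), Γ.twist j r.2.1, Γ.twist j r.2.2),
        (flipAt (Γ.twist j r.2.2) (flipAt (Γ.twist j r.2.1) (Γ.twist j r.1)), Γ.twist j r.2.1, Γ.twist j r.2.2),
        (Γ.twist j r.1, Γ.twist j r.2.2, Γ.twist j r.2.1),
        (flipAt (Γ.twist j r.2.1) (Γ.twist j r.1), Γ.twist j r.2.2, Γ.twist j r.2.1),
        (flipAt (Γ.twist j r.2.2) (Γ.twist j r.1), Γ.twist j r.2.2, Γ.twist j r.2.1),
        (flipAt (Γ.twist j r.2.2) (flipAt (Γ.twist j r.2.1) (Γ.twist j r.1)), Γ.twist j r.2.2, Γ.twist j r.2.1)].contains gi.1)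
      = true)
    (hpc : (certs.all fun c => c.2.2.all fun pj => Γ.isCMType pj.1) = true)
    (σ₀ : (K : Type) →+* ℂ) (𝒮 : Set (Face K))
    (hreps : ∀ r ∈ reps, ∃ R ∈ 𝒮, (r.1 < 2 ^ n ∧ ∀ i : Fin n, mem i r.1 = true ↔ e.symm i ∈ (pullType R.Φ σ₀).1) ∧
      Γ.placeMask (e (translate σ₀ R.p)) = r.2.1 ∧ Γ.placeMask (e (translate σ₀ R.p')) = r.2.2)
    (h : ∀ f ∈ 𝒮, ∃ ι₁ : K →+* ℂ, f.Admissible ι₁ ∧ ∃ (V : HermSpace3 K ι₁) (σ : K →+* ℂ),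
      (Model.picardCMUniverse exists_isReal_hodgeModel_holds hodgePQ_independent_of_hodgeModel_holds
        BallQuotient.ballQuotientUniformised_holds cmAbelianVarietyRealised_holds).PeriodNV ι₁ V K f.psi σ)
    {P A : AbelianVariety ℂ} (hP : AbelianVariety.IsProductOf (fun B : AbelianVariety ℂ =>
      ∃ (E : Type) (_ : Field E) (_ : NumberField E) (_ : IsCMField E) (_ : E →+* (K : Type)) (Φ : CMType E)
        (ι : 𝓞 E →+* End B) (θ : E →+* Module.End ℂ (complexBetti B.X 1)),
        IsCMTypeRealisation Φ B ι θ) P)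
    (hA : AVDominatedBy A P) : HodgeConjectureFor A.dim A.X :=
  hodgeConjectureFor_of_avDominatedBy_isProductOf_of_exists_facePeriod_on K (h6.trans_eq (FaceCensus.eq_finrank_of_enum e)) 𝒮 σ₀
    (FaceCensus.hgen_of_generationCertOK Γ e hmul hconj reps certs hcert horb hpc σ₀ 𝒮 hreps) h hP hA

end Summit.HodgeConjecture.CorCM

end
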